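import Literature.AlgebraicGeometry.Morphisms.CechH2FibreDimOne
import Literature.AlgebraicGeometry.Morphisms.CechH1PreimageGluing
import Literature.AlgebraicGeometry.Morphisms.CechModuleH2TwoCover
import Literature.AlgebraicGeometry.Morphisms.CechModuleH2CoverIndependence
import Literature.AlgebraicGeometry.Morphisms.ProjectiveAffineCoverFibreDim
import HarnessLib

/-!
# `Ȟ² = 0` on a projective scheme over a local ring whose closed fibre has dimension `≤ 1`
# (Görtz–Wedhorn II, Corollary 24.44 in Čech form — the PROJECTIVE case, proved)

Topic: `Literature/AlgebraicGeometry/Morphisms` (sibling of `CechH2FibreDimOne.lean`, which carries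
the NAMED FACT `GortzWedhorn2023_24_44_H2`: for `f : X → Spec A` proper over a Noetherian local ring
with all fibres of dimension `≤ 1` and `M` affine-localizing, `Ȟ²(𝒰, M) = 0` on every finite affine
open cover, in the full ordered Čech complex `CechMH2`).  This file PROVES that statement — fact-free,
standard axioms — under the one extra hypothesis that `f` is PROJECTIVE
(`Crystalline.IsProjectiveOverRing (Over.mk f)`: a closed `A`-immersion into some `ℙⁿ_A`; e.g. every
blowing up of `Spec A`, `Resolution.IsBlowup.isProjectiveOverRing_of_isAffine`), and in fact in a
stronger form: `A` any local ring, only the CLOSED fibre of dimension `≤ 1`, any family of affine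
opens covering `X` (no finiteness).

## The proof (elementary; no formal functions)

1. (b′, `ProjectiveAffineCoverFibreDim`) hypersurface avoidance on the closed fibre inside the
   ambient `ℙⁿ_A` and "an open subset containing the closed fibre of a closed morphism to a local
   scheme is everything": `X` is covered by TWO affine opens
   (`exists_isAffineOpen_iSup_eq_top_of_isProjectiveOverRing`, `n = 2`);
2. (a′, `CechModuleH2TwoCover`) the full ordered Čech complex of ANY sheaf of modules on a family of
   at most two opens has `Ȟ² = 0` (`subsingleton_cechMH2_fin_two`; explicit primitive);
3. (c′, `CechModuleH2CoverIndependence`) for `M` affine-localizing on a separated scheme,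
   `Ȟ²(𝒰, M) = 0` does not depend on the affine open cover (`subsingleton_cechMH2_iff_of_isSeparated`;
   double complex of two covers + Görtz–Wedhorn II Lemma 22.1 in degree `2`); `X` is separated, being
   proper (`isProper_of_isProjectiveOverRing`) over the affine `Spec A`.

## Contents

* `subsingleton_cechMH2_of_isProjectiveOverRing` — the strong form;
* `GortzWedhorn2023_24_44_H2_of_projective` — **the named fact's binders verbatim with
  `IsProjectiveOverRing (Over.mk f) →` inserted after `[IsProper f]`** (drop-in partial discharge: a
  consumer holding `hproj` replaces `h A X f hfib M hM ι U hU hcov` by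
  `GortzWedhorn2023_24_44_H2_of_projective A X f hproj hfib M hM ι U hU hcov`);
* consumer twins of the fact's corollaries: `cechMapH1_surjective_of_isProjectiveOverRing`
  (`Ȟ¹` right exact on short exact sequences with affine-localizing kernel; twin of
  `GortzWedhorn2023_24_44_H2.cechMapH1_surjective`), `…_of_isQuasicoherent`,
  `cechZ2_exact_of_isProjectiveOverRing` (structure sheaf: the hypothesis `hH2` of
  `cechH1_glue_of_cechZ2_family_exact`), `cechZ2_exact_preimageFamily_of_isProjectiveOverRing` (twin
  of `cechZ2_exact_preimageFamily_of_GW`, `CechH1PreimageGluing` §2).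

## What is NOT here (honesty)

The general fact `GortzWedhorn2023_24_44_H2` (proper, NOT necessarily projective `f`) STAYS A NAMED
FACT: its printed proofs (Görtz–Wedhorn II 24.42–24.44, EGA III (4.2.2), Hartshorne III 11.2) go
through the theorem on formal functions; nor is it proved here that a resolution of a
two-dimensional normal local ring is projective over it.  No statement of any summit is proved by
this file.

## References

* U. Görtz, T. Wedhorn, *Algebraic Geometry II: Cohomology of Schemes*, Springer Spektrum (2023),
  doi:10.1007/978-3-658-43031-3: Cor. 24.44; Lemma 22.1; (21.16). [GortzWedhorn2023]
* R. Hartshorne, *Algebraic Geometry*, GTM 52 (1977): III Ex. 4.8 (d) (covering by few affines),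
  III Thm. 4.5 (cover independence), III Cor. 11.2 (the projective statement over any Noetherian
  base, via formal functions). [Hartshorne1977]
-/

noncomputable section

open CategoryTheory AlgebraicGeometry TopologicalSpace IsLocalRing

universe u v w

namespace Literature.AlgebraicGeometry.Morphisms

/-! ## The projective case of Görtz–Wedhorn II Cor. 24.44 -/

section Projective

variable {A : Type u} [CommRing A] [IsLocalRing A] {X : Scheme.{u}} (f : X ⟶ Spec (.of A))

/-- **`Ȟ²(𝒰, M) = 0` on a projective scheme over a local ring whose closed fibre has dimension
`≤ 1`** (Görtz–Wedhorn II Cor. 24.44 / Hartshorne III Ex. 4.8 (d) route, PROVED, fact-free): for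
`A` local (not necessarily Noetherian), `f : X → Spec A` projective
(`Crystalline.IsProjectiveOverRing`), `dim X_𝔪 ≤ 1` for the closed fibre, `M` an affine-localizing
(e.g. quasi-coherent) `𝒪_X`-module and ANY family of affine opens `𝒰` covering `X` (any index
type), the second Čech cohomology of the full ordered Čech complex vanishes: `X` is covered by two
affine opens (hypersurface avoidance on the closed fibre), `Ȟ²` of a two-member family is zero, and
`Ȟ² = 0` is independent of the affine cover on the separated `X`.
[cite: GortzWedhorn2023, Cor. 24.44 (projective case)] -/
theorem subsingleton_cechMH2_of_isProjectiveOverRing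
    (hf : Crystalline.IsProjectiveOverRing (Over.mk f : Motives.SchemeOver A))
    (hdim : topologicalKrullDim (f.fiber (closedPoint A)) ≤ 1) {M : X.Modules}
    (hM : Literature.AlgebraicGeometry.Modules.IsAffineLocalizing M) {ι : Type v}
    (U : ι → X.Opens) (hU : ∀ i, IsAffineOpen (U i)) (hcov : ⨆ i, U i = ⊤) :
    Subsingleton (CechMH2 f M U) := by
  haveI : IsProper f := isProper_of_isProjectiveOverRing f hf
  haveI : X.IsSeparated := ⟨by rw [← Limits.terminal.comp_from f]; infer_instance⟩
  have hlt : topologicalKrullDim (f.fiber (closedPoint A)) < ((2 : ℕ) : WithBot ℕ∞) :=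
    lt_of_le_of_lt hdim (by decide)
  obtain ⟨V, hVaff, hVcov⟩ := exists_isAffineOpen_iSup_eq_top_of_isProjectiveOverRing f hf 2 hlt
  exact (subsingleton_cechMH2_iff_of_isSeparated f hM U V hU hVaff hcov hVcov).mpr
    (subsingleton_cechMH2_fin_two f M V)

/-- **Görtz–Wedhorn II, Corollary 24.44 in Čech form — the PROJECTIVE case, PROVED**: the named
fact `GortzWedhorn2023_24_44_H2` (file `CechH2FibreDimOne`) with the one extra hypothesis that
`f` is projective (`Crystalline.IsProjectiveOverRing (Over.mk f)`), binders otherwise verbatim: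
for `A` Noetherian local, `f : X → Spec A` proper AND projective with all fibres of topological
Krull dimension `≤ 1`, `M` affine-localizing and every finite affine open cover `𝒰` of `X`,
`Ȟ²(𝒰, M) = 0` (`subsingleton_cechMH2_of_isProjectiveOverRing`; only the closed fibre, no
Noetherianity and no finiteness of the cover are actually used). The general (proper,
non-projective) fact stays a named fact. [cite: GortzWedhorn2023, Cor. 24.44 (projective case)] -/
theorem GortzWedhorn2023_24_44_H2_of_projective :
    ∀ (A : Type u) [CommRing A] [IsNoetherianRing A] [IsLocalRing A] (X : Scheme.{u})
      (f : X ⟶ Spec (.of A)) [IsProper f],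
      Crystalline.IsProjectiveOverRing (Over.mk f : Motives.SchemeOver A) →
      (∀ y : Spec (.of A), topologicalKrullDim (f.fiber y) ≤ 1) →
      ∀ (M : X.Modules), Literature.AlgebraicGeometry.Modules.IsAffineLocalizing M →
        ∀ (ι : Type u) [Finite ι] (U : ι → X.Opens),
          (∀ i, IsAffineOpen (U i)) → ⨆ i, U i = ⊤ → Subsingleton (CechMH2 f M U) :=
  fun A _ _ _ _ f _ hf hfib _ hM _ _ U hU hcov =>
    subsingleton_cechMH2_of_isProjectiveOverRing f hf (hfib (closedPoint A)) hM U hU hcov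

/-- **The named fact holds for projective `f`**: `GortzWedhorn2023_24_44_H2` restricted to
projective morphisms — restatement of `GortzWedhorn2023_24_44_H2_of_projective` showing the binder
shapes agree (a consumer holding `hproj` replaces `h A X f hfib …` by
`GortzWedhorn2023_24_44_H2_of_projective A X f hproj hfib …`). [cite: GortzWedhorn2023, Cor. 24.44 (projective case)] -/
example (h : GortzWedhorn2023_24_44_H2.{u}) (A : Type u) [CommRing A] [IsNoetherianRing A]
    [IsLocalRing A] (X : Scheme.{u}) (f : X ⟶ Spec (.of A)) [IsProper f]
    (hfib : ∀ y : Spec (.of A), topologicalKrullDim (f.fiber y) ≤ 1) (M : X.Modules)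
    (hM : Literature.AlgebraicGeometry.Modules.IsAffineLocalizing M) (ι : Type u) [Finite ι]
    (U : ι → X.Opens) (hU : ∀ i, IsAffineOpen (U i)) (hcov : ⨆ i, U i = ⊤) :
    Subsingleton (CechMH2 f M U) :=
  h A X f hfib M hM ι U hU hcov

variable {ι : Type u} (U : ι → X.Opens)

/-- **`Ȟ¹` is right exact on a projective scheme over a local ring with closed fibre of dimension
`≤ 1`** (fact-free; the projective case of `GortzWedhorn2023_24_44_H2.cechMapH1_surjective`): for
a short exact sequence `0 → M′ → M → M″ → 0` of `𝒪_X`-modules with `M′` affine-localizing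
(quasi-coherent) and any family of affine opens `𝒰` covering `X`, `Ȟ¹(𝒰, M) → Ȟ¹(𝒰, M″)` is
surjective. [cite: GortzWedhorn2023, Cor. 24.44 (projective case)] -/
theorem cechMapH1_surjective_of_isProjectiveOverRing
    (hf : Crystalline.IsProjectiveOverRing (Over.mk f : Motives.SchemeOver A))
    (hdim : topologicalKrullDim (f.fiber (closedPoint A)) ≤ 1)
    {S : ShortComplex X.Modules} (hS : S.ShortExact)
    (h₁ : Literature.AlgebraicGeometry.Modules.IsAffineLocalizing S.X₁)
    (hU : ∀ i, IsAffineOpen (U i)) (hcov : ⨆ i, U i = ⊤) :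
    Function.Surjective (cechMapH1 f S.g U) :=
  haveI : IsProper f := isProper_of_isProjectiveOverRing f hf
  haveI : X.IsSeparated := ⟨by rw [← Limits.terminal.comp_from f]; infer_instance⟩
  cechMapH1_surjective_of_shortExact f U hS h₁ hU (fun i j => (hU i).inf (hU j))
    (subsingleton_cechMH2_of_isProjectiveOverRing f hf hdim h₁ U hU hcov)

/-- The same for a short exact sequence whose kernel is quasi-coherent in Mathlib's sense
(`SheafOfModules.IsQuasicoherent`). [cite: GortzWedhorn2023, Cor. 24.44 (projective case)] -/
theorem cechMapH1_surjective_of_isProjectiveOverRing_of_isQuasicoherent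
    (hf : Crystalline.IsProjectiveOverRing (Over.mk f : Motives.SchemeOver A))
    (hdim : topologicalKrullDim (f.fiber (closedPoint A)) ≤ 1)
    {S : ShortComplex X.Modules} (hS : S.ShortExact) [S.X₁.IsQuasicoherent]
    (hU : ∀ i, IsAffineOpen (U i)) (hcov : ⨆ i, U i = ⊤) :
    Function.Surjective (cechMapH1 f S.g U) :=
  cechMapH1_surjective_of_isProjectiveOverRing f U hf hdim hS
    (Literature.AlgebraicGeometry.Modules.IsAffineLocalizing.of_isQuasicoherent S.X₁) hU hcov

end Projective

/-! ## Consumer shapes for the structure sheaf and for preimage families (projective twins of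
`CechH1PreimageGluing` §1–§2) -/

section Preimage

variable {A : Type u} [CommRing A] [IsLocalRing A] {B Z : Scheme.{u}}

/-- **(H2V) for `𝒪_X` on a projective scheme over a local ring with closed fibre of dimension
`≤ 1`** (fact-free): every Čech `2`-cocycle of the structure sheaf on a family of affine opens
covering `X` is a `2`-coboundary — `subsingleton_cechMH2_of_isProjectiveOverRing` for the unit
module (`IsAffineLocalizing.unit`) read through `cechZ2_exact_of_subsingleton_cechMH2_unit`; this
is the hypothesis `hH2` of `cechH1_glue_of_cechZ2_family_exact` / `cechRefineH1_piece_surjective`.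
[cite: GortzWedhorn2023, Cor. 24.44 (projective case)] -/
theorem cechZ2_exact_of_isProjectiveOverRing (g : B ⟶ Spec (.of A))
    (hg : Crystalline.IsProjectiveOverRing (Over.mk g : Motives.SchemeOver A))
    (hfib : topologicalKrullDim (g.fiber (closedPoint A)) ≤ 1) {α : Type v} (W : α → B.Opens)
    (hW : ∀ a, IsAffineOpen (W a)) (hcov : ⨆ a, W a = ⊤) :
    ∀ e : CechC2 g W, cechD2 g W e = 0 → ∃ c : CechC1 g W, cechD1 g W c = e :=
  cechZ2_exact_of_subsingleton_cechMH2_unit g W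
    (subsingleton_cechMH2_of_isProjectiveOverRing g hg hfib
      Literature.AlgebraicGeometry.Modules.IsAffineLocalizing.unit W hW hcov)

/-- **(H2V) for the pieces `ρ⁻¹W_a` over a PROJECTIVE `B` with closed fibre of dimension `≤ 1`**
(fact-free projective twin of `cechZ2_exact_preimageFamily_of_GW`): for `g : B → Spec A`
projective over the local ring `A` with `dim B_𝔪 ≤ 1`, `ρ : Z → B` with `Z` Noetherian (so that
`ρ_*𝒪_Z` is affine-localizing, `isAffineLocalizing_pushforward`) and a family `𝒲` of affine opens
covering `B`, every Čech `2`-cocycle of `𝒪_Z` on `(ρ⁻¹W_a)_a` is a `2`-coboundary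
(`Č•((ρ⁻¹W_a), 𝒪_Z) = Č•(𝒲, ρ_*𝒪_Z)` and `Ȟ²(𝒲, ρ_*𝒪_Z) = 0`).
[cite: GortzWedhorn2023, Cor. 24.44 (projective case)] -/
theorem cechZ2_exact_preimageFamily_of_isProjectiveOverRing (g : B ⟶ Spec (.of A))
    (hg : Crystalline.IsProjectiveOverRing (Over.mk g : Motives.SchemeOver A))
    (hfib : topologicalKrullDim (g.fiber (closedPoint A)) ≤ 1)
    (ρ : Z ⟶ B) [NoetherianSpace Z] (f : Z ⟶ Spec (.of A)) (hf : ρ ≫ g = f)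
    {α : Type u} (W : α → B.Opens) (hW : ∀ a, IsAffineOpen (W a)) (hcov : ⨆ a, W a = ⊤) :
    ∀ e : CechC2 f (preimageFamily ρ W), cechD2 f (preimageFamily ρ W) e = 0 →
      ∃ c : CechC1 f (preimageFamily ρ W), cechD1 f (preimageFamily ρ W) c = e :=
  cechZ2_exact_preimageFamily_of_subsingleton_cechMH2_pushforward g W f ρ hf
    (subsingleton_cechMH2_of_isProjectiveOverRing g hg hfib
      (isAffineLocalizing_pushforward ρ Literature.AlgebraicGeometry.Modules.IsAffineLocalizing.unit)
      W hW hcov)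

end Preimage

end Literature.AlgebraicGeometry.Morphisms

end
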